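import Summits.Ventures.CertifiedManyBodySolver.Downfold.EmeryVanHoveFactorisation
import HarnessLib

/-!
# The van Hove doping of the σ three-band model, box rule: `u = 2(t_pp + t_pp′)/(Δ + ε_VH)` and ONE rational check per
# parameter box (companion of `EmeryVanHoveFactorisation`)

Venture CertifiedManyBodySolver, cell `pub/hubbard-downfold` (stage S1, HUMAN RULINGS D-0096/D-0098), seat hubbard-downfold-mod-4
(technique B = band level); namespace `Summit.Ventures.CertifiedManyBodySolver.Downfold.Emery`. Everything here is PROVED. WHAT THIS
IS NOT: a statement about any material; no number lives here; `U = 0` band kinematics of the σ model.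

`EmeryVanHoveFactorisation` proves `x_VH = 1 − 2Ψ(q)`, `q = u(1 + u)`, `u = ε_VH(t_pp + t_pp′)/(2(t_pd² − t_pp′ε_VH))`, under
`fsD(ε_VH) > 0` and the separation condition `VHSep`. Here:

* `tpd_sq_sub_vh`, `vhU_eq` — at the saddle energy `t_pd² − t_pp′ε_VH = ε_VH(ε_VH + Δ)/4`, so positivity of `fsD(ε_VH)` is free
  (`fsD_vh_pos`) and **`u = 2(t_pp + t_pp′)/(Δ + ε_VH)`**: the van Hove doping of the σ model depends on its four band parameters
  ONLY through the ratio of the oxygen–oxygen hopping to `Δ + ε_VH`; `u` is monotone in each parameter, and `Δ + ε_VH` has exact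
  corner brackets (`le_add_vhEnergy`, `add_vhEnergy_le`, sqrt-free);
* `vhBoxCheck Δ₁ Δ₂ a₁ a₂ b₁ b₂ c₁ c₂ v₁ v₂ e E q₁ q₂` — the rational side conditions of ONE parameter box
  `Δ ∈ [Δ₁, Δ₂]`, `t_pd ∈ [a₁, a₂]`, `t_pp ∈ [b₁, b₂]`, `t_pp′ ∈ [c₁, c₂]`: bracket criteria for `ε_VH ∈ [v₁, v₂]` and for
  `Δ + ε_VH ∈ [Δ₁ + e, Δ₂ + E]` at the worst corners, the `q`-bracket through `u₁ = 2(c₁ + b₁)/(Δ₂ + E)`, `u₂ = 2(c₂ + b₂)/(Δ₁ + e)`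
  (CORNER-EXACT: no sub-division needed), and the separation MARGIN `4a₂² + 4b₂² ≤ (Δ₁ + e)(Δ₁ + e + 2v₁)` (on the triangle
  `x + y ≤ 1`, `∂_ε charCubic ≥ (Δ + ε)(Δ + 3ε) − 4t_pd² − 4t_pp²`);
* `xVH_window_of_vhBoxCheck` — THE BOX RULE: the check ⇒ at every point `ε_VH ∈ [v₁, v₂]`, `Δ + ε_VH ∈ [Δ₁ + e, Δ₂ + E]`,
  `q ∈ [q₁, q₂]`, `VHSep`, `x_VH = 1 − 2Ψ(q)`, `x_VH ∈ [1 − 2Ψ(q₁), 1 − 2Ψ(q₂)]` (one `decide` in consumers);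
* `xVH_window_of_table` — inserts two certified entries of the table of `Ψ` (`EmeryVanHoveTable`) to get a numeric window.

Sources: [HybertsenSchluterChristensen1989, Eq. (1)]; [AndersenEtAl1995, §6]; interval arithmetic [folklore] (Moore 1966).
-/

noncomputable section

namespace Summit.Ventures.CertifiedManyBodySolver.Downfold.Emery

open Real Set

/-! ## The reduced variable in corner-monotone form -/

/-- AT THE SADDLE ENERGY `t_pd² − t_pp′ε_VH = ε_VH(ε_VH + Δ)/4` (the secular equation at X). [folklore] -/
theorem tpd_sq_sub_vh (Δ tpd c : ℝ) :
    tpd ^ 2 - c * vhEnergy Δ tpd c = vhEnergy Δ tpd c * (vhEnergy Δ tpd c + Δ) / 4 := by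
  have hq := vhEnergy_quad Δ tpd c
  linarith

/-- Hence `t_pd² − t_pp′ε_VH > 0` and `fsD(ε_VH) > 0` for FREE when `Δ ≥ 0`, `t_pd ≠ 0`. [folklore] -/
theorem fsD_vh_pos {Δ tpd : ℝ} (hΔ : 0 ≤ Δ) (htpd : tpd ≠ 0) (c : ℝ) :
    0 < tpd ^ 2 - c * vhEnergy Δ tpd c ∧ 0 < fsD Δ tpd c (vhEnergy Δ tpd c) := by
  have hv := vhEnergy_pos Δ htpd c
  have hw : 0 < tpd ^ 2 - c * vhEnergy Δ tpd c := by rw [tpd_sq_sub_vh]; positivity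
  refine ⟨hw, ?_⟩
  have h4 : 0 < vhEnergy Δ tpd c * fsD Δ tpd c (vhEnergy Δ tpd c) := by
    rw [vhEnergy_mul_fsD]; positivity
  exact pos_of_mul_pos_right h4 hv.le

/-- **THE REDUCED VARIABLE IS `u = 2(t_pp + t_pp′)/(Δ + ε_VH)`** (`Δ ≥ 0`, `t_pd ≠ 0`): monotone increasing in `t_pp`, `t_pp′`,
decreasing in `Δ` and `t_pd` (through `Δ + ε_VH`). [folklore] -/
theorem vhU_eq {Δ tpd : ℝ} (hΔ : 0 ≤ Δ) (htpd : tpd ≠ 0) (tpp c : ℝ) :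
    vhU Δ tpd tpp c = 2 * (c + tpp) / (Δ + vhEnergy Δ tpd c) := by
  have hv := vhEnergy_pos Δ htpd c
  unfold vhU
  rw [tpd_sq_sub_vh, div_eq_div_iff (by positivity) (by positivity)]
  ring

/-- UPPER CORNER of `Δ + ε_VH` on a box: `Δ ≤ Δ₂`, `t_pd² ≤ A₂`, `c₁ ≤ t_pp′`, `Δ + 4t_pp′ ≥ 0`, and a rational `E ≥ 0` with
`E² + (Δ₂ + 4c₁)E − 4A₂ ≥ 0` (i.e. `E ≥ ε_VH` at the corner `(Δ₂, a₂, c₁)`) ⇒ `Δ + ε_VH ≤ Δ₂ + E`. [folklore] -/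
theorem add_vhEnergy_le {Δ tpd c Δ₂ A₂ c₁ E : ℝ} (hΔ : Δ ≤ Δ₂) (hA : tpd ^ 2 ≤ A₂) (hc : c₁ ≤ c) (hD4 : 0 ≤ Δ + 4 * c)
    (hE : 0 ≤ E) (hq : 0 ≤ E ^ 2 + (Δ₂ + 4 * c₁) * E - 4 * A₂) : Δ + vhEnergy Δ tpd c ≤ Δ₂ + E := by
  set d := Δ₂ - Δ with hd
  have hd0 : 0 ≤ d := by rw [hd]; linarith
  have key : (E + d) ^ 2 + (Δ + 4 * c) * (E + d) - 4 * tpd ^ 2 =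
      (E ^ 2 + (Δ₂ + 4 * c₁) * E - 4 * A₂) + (E * d + d ^ 2 + (Δ + 4 * c) * d + 4 * (c - c₁) * E + 4 * (A₂ - tpd ^ 2)) := by
    rw [hd]; ring
  have hpos : 0 ≤ (E + d) ^ 2 + (Δ + 4 * c) * (E + d) - 4 * tpd ^ 2 := by
    rw [key]
    have e1 : 0 ≤ E * d := mul_nonneg hE hd0
    have e2 : 0 ≤ (Δ + 4 * c) * d := mul_nonneg hD4 hd0
    have e3 : 0 ≤ 4 * (c - c₁) * E := by nlinarith
    nlinarith [sq_nonneg d]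
  have := vhEnergy_le_of_quad_nonneg (by positivity) hD4 hpos
  rw [hd] at this; linarith

/-- LOWER CORNER of `Δ + ε_VH` on a box: `Δ₁ ≤ Δ` (`Δ₁ ≥ 0`), `A₁ ≤ t_pd²`, `0 ≤ t_pp′ ≤ c₂`, and a rational `e ≥ 0` with
`e² + (Δ₁ + 4c₂)e − 4A₁ ≤ 0` (i.e. `e ≤ ε_VH` at the corner `(Δ₁, a₁, c₂)`) ⇒ `Δ₁ + e ≤ Δ + ε_VH`. [folklore] -/
theorem le_add_vhEnergy {Δ tpd c Δ₁ A₁ c₂ e : ℝ} (hΔ₁ : 0 ≤ Δ₁) (hΔ : Δ₁ ≤ Δ) (hA : A₁ ≤ tpd ^ 2) (hc0 : 0 ≤ c)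
    (hc : c ≤ c₂) (he : 0 ≤ e) (hq : e ^ 2 + (Δ₁ + 4 * c₂) * e - 4 * A₁ ≤ 0) : Δ₁ + e ≤ Δ + vhEnergy Δ tpd c := by
  have hv0 := vhEnergy_nonneg Δ tpd c
  have hΔ0 : 0 ≤ Δ := hΔ₁.trans hΔ
  set d := Δ - Δ₁ with hd
  have hd0 : 0 ≤ d := by rw [hd]; linarith
  rcases le_or_gt (e - d) 0 with hneg | hpos
  · rw [hd] at hneg; linarith
  · have key : (e - d) ^ 2 + (Δ + 4 * c) * (e - d) - 4 * tpd ^ 2 =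
        (e ^ 2 + (Δ₁ + 4 * c₂) * e - 4 * A₁) - (4 * (c₂ - c) * e + e * d + (Δ₁ + 4 * c) * d + 4 * (tpd ^ 2 - A₁)) := by
      rw [hd]; ring
    have hnp : (e - d) ^ 2 + (Δ + 4 * c) * (e - d) - 4 * tpd ^ 2 ≤ 0 := by
      rw [key]
      have e1 : 0 ≤ 4 * (c₂ - c) * e := by nlinarith
      have e2 : 0 ≤ e * d := mul_nonneg he hd0
      have e3 : 0 ≤ (Δ₁ + 4 * c) * d := by positivity
      nlinarith
    have := le_vhEnergy_of_quad_nonpos (by positivity) hnp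
    rw [hd] at this; linarith

/-! ## The box rule: ONE rational check per parameter box -/

/-- Lower corner of `u` on a box: `u₁ = 2(c₁ + b₁)/(Δ₂ + E)`. [folklore] -/
def vhULo (Δ₂ b₁ c₁ E : ℚ) : ℚ := 2 * (c₁ + b₁) / (Δ₂ + E)

/-- Upper corner of `u` on a box: `u₂ = 2(c₂ + b₂)/(Δ₁ + e)`. [folklore] -/
def vhUHi (Δ₁ b₂ c₂ e : ℚ) : ℚ := 2 * (c₂ + b₂) / (Δ₁ + e)

/-- THE RATIONAL CHECK of a van Hove box certificate on `Δ ∈ [Δ₁, Δ₂]`, `t_pd ∈ [a₁, a₂]`, `t_pp ∈ [b₁, b₂]`, `t_pp′ ∈ [c₁, c₂]`: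
order/sign conditions; the bracket criteria of `EmeryVanHoveDoping` for `ε_VH ∈ [v₁, v₂]` at the worst corners; corner brackets
`e ≤ ε_VH(Δ₁, a₁, c₂)`, `ε_VH(Δ₂, a₂, c₁) ≤ E` (so `Δ + ε_VH ∈ [Δ₁ + e, Δ₂ + E]`); the `q`-bracket `q₁ ≤ u₁(1 + u₁)`,
`u₂(1 + u₂) ≤ q₂`; and the separation margin `4a₂² + 4b₂² ≤ (Δ₁ + e)(Δ₁ + e + 2v₁)`. [folklore] -/
def vhBoxCheck (Δ₁ Δ₂ a₁ a₂ b₁ b₂ c₁ c₂ v₁ v₂ e E q₁ q₂ : ℚ) : Bool :=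
  decide (0 < a₁) && decide (a₁ ≤ a₂) && decide (0 ≤ c₁) && decide (c₁ ≤ c₂) && decide (c₂ ≤ b₁) &&
  decide (b₁ ≤ b₂) && decide (0 ≤ Δ₁) && decide (Δ₁ ≤ Δ₂) && decide (0 < v₁) && decide (v₁ ≤ v₂) &&
  decide (v₁ ^ 2 + (Δ₂ + 4 * c₂) * v₁ - 4 * a₁ ^ 2 ≤ 0) && decide (0 ≤ v₂ ^ 2 + (Δ₁ + 4 * c₁) * v₂ - 4 * a₂ ^ 2) &&
  decide (0 ≤ e) && decide (e ^ 2 + (Δ₁ + 4 * c₂) * e - 4 * a₁ ^ 2 ≤ 0) &&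
  decide (0 ≤ E) && decide (0 ≤ E ^ 2 + (Δ₂ + 4 * c₁) * E - 4 * a₂ ^ 2) && decide (0 < Δ₁ + e) &&
  decide (q₁ ≤ vhULo Δ₂ b₁ c₁ E * (1 + vhULo Δ₂ b₁ c₁ E)) &&
  decide (vhUHi Δ₁ b₂ c₂ e * (1 + vhUHi Δ₁ b₂ c₂ e) ≤ q₂) &&
  decide (4 * a₂ ^ 2 + 4 * b₂ ^ 2 ≤ (Δ₁ + e) * (Δ₁ + e + 2 * v₁))

/-- `u(1 + u)` is monotone on `u ≥ 0`. [folklore] -/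
theorem mul_one_add_mono {u₁ u₂ : ℝ} (h0 : 0 ≤ u₁) (h : u₁ ≤ u₂) : u₁ * (1 + u₁) ≤ u₂ * (1 + u₂) := by nlinarith

/-- SEPARATION FROM A MARGIN: `s₁ ≤ Δ + ε_VH`, `v₁ ≤ ε_VH` (`s₁, v₁ ≥ 0`), `t_pd² ≤ A`, `t_pp² ≤ B`, `Δ, t_pp′ ≥ 0` and
`4A + 4B ≤ s₁(s₁ + 2v₁)` ⇒ `VHSep` (on the triangle `x + y ≤ 1` one has `4xy ≤ 1`, so
`∂_ε charCubic ≥ (Δ + ε)(Δ + 3ε) − 4t_pd² − 4t_pp²`). [folklore] -/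
theorem vhSep_of_margin {Δ tpd tpp c s₁ v₁ A B : ℝ} (hs₀ : 0 ≤ s₁) (hv₀ : 0 ≤ v₁) (hs : s₁ ≤ Δ + vhEnergy Δ tpd c)
    (hv : v₁ ≤ vhEnergy Δ tpd c) (hA : tpd ^ 2 ≤ A) (hB : tpp ^ 2 ≤ B) (hΔ : 0 ≤ Δ) (hc : 0 ≤ c)
    (hm : 4 * A + 4 * B ≤ s₁ * (s₁ + 2 * v₁)) : VHSep Δ tpd tpp c := by
  intro x y hx hy hxy
  set v := vhEnergy Δ tpd c
  have hv0 : 0 ≤ v := hv₀.trans hv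
  have hform : dcharCubic Δ tpd tpp c x y v =
      (Δ + v) * ((Δ + v) + 2 * v) - 4 * (tpd ^ 2 * (x + y)) + 4 * (c * (Δ + 2 * v) * (x + y))
        - 4 * (tpp ^ 2 * (4 * (x * y))) + 16 * (c ^ 2 * (x * y)) := by
    unfold dcharCubic dcA dfsD dfsN; ring
  have p1 : s₁ * (s₁ + 2 * v₁) ≤ (Δ + v) * ((Δ + v) + 2 * v) :=
    mul_le_mul hs (by linarith) (by positivity) (by positivity)
  have hs2 : (x + y) * (x + y) ≤ 1 := by
    have := mul_le_mul hxy hxy (by positivity) zero_le_one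
    simpa using this
  have hxy4 : 4 * (x * y) ≤ 1 := by nlinarith [sq_nonneg (x - y), hs2]
  have p2 : tpd ^ 2 * (x + y) ≤ A := by
    have := mul_le_mul_of_nonneg_left hxy (sq_nonneg tpd)
    linarith
  have p3 : tpp ^ 2 * (4 * (x * y)) ≤ B := by
    have := mul_le_mul_of_nonneg_left hxy4 (sq_nonneg tpp)
    linarith
  have p4 : 0 ≤ c * (Δ + 2 * v) * (x + y) := by positivity
  have p5 : 0 ≤ c ^ 2 * (x * y) := by positivity
  rw [hform]
  linarith

/-- **THE VAN HOVE BOX RULE (exact factorisation, corner-exact `q`-bracket).** On a box passing `vhBoxCheck`, at every parameter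
point: `ε_VH ∈ [v₁, v₂]`, `Δ + ε_VH ∈ [Δ₁ + e, Δ₂ + E]`, `q ∈ [q₁, q₂]`, separation holds, `x_VH = 1 − 2Ψ(q)`, and
`x_VH ∈ [1 − 2Ψ(q₁), 1 − 2Ψ(q₂)]`. [folklore] -/
theorem xVH_window_of_vhBoxCheck {Δ₁ Δ₂ a₁ a₂ b₁ b₂ c₁ c₂ v₁ v₂ e E q₁ q₂ : ℚ}
    (hchk : vhBoxCheck Δ₁ Δ₂ a₁ a₂ b₁ b₂ c₁ c₂ v₁ v₂ e E q₁ q₂ = true)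
    {Δ tpd tpp c : ℝ} (hΔ : Δ ∈ Set.Icc (Δ₁ : ℝ) Δ₂) (ha : tpd ∈ Set.Icc (a₁ : ℝ) a₂)
    (hb : tpp ∈ Set.Icc (b₁ : ℝ) b₂) (hc : c ∈ Set.Icc (c₁ : ℝ) c₂) :
    vhEnergy Δ tpd c ∈ Set.Icc (v₁ : ℝ) v₂ ∧ Δ + vhEnergy Δ tpd c ∈ Set.Icc ((Δ₁ : ℝ) + e) ((Δ₂ : ℝ) + E) ∧
      vhRatio Δ tpd tpp c ∈ Set.Icc (q₁ : ℝ) q₂ ∧ VHSep Δ tpd tpp c ∧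
      xVH Δ tpd tpp c = 1 - 2 * vhFrac (vhRatio Δ tpd tpp c) ∧
      xVH Δ tpd tpp c ∈ Set.Icc (1 - 2 * vhFrac q₁) (1 - 2 * vhFrac q₂) := by
  simp only [vhBoxCheck, Bool.and_eq_true, decide_eq_true_eq] at hchk
  obtain ⟨⟨⟨⟨⟨⟨⟨⟨⟨⟨⟨⟨⟨⟨⟨⟨⟨⟨⟨qa₁, qa⟩, qc₁⟩, qc⟩, qcb⟩, qb⟩, qΔ₁⟩, qΔ⟩, qv₁⟩, qv⟩, qlo⟩, qhi⟩, qe0⟩, qe⟩, qE0⟩,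
    qE⟩, qs₁⟩, qq₁⟩, qq₂⟩, qsep⟩ := hchk
  obtain ⟨hΔlo, hΔhi⟩ := hΔ
  obtain ⟨halo, hahi⟩ := ha
  obtain ⟨hblo, hbhi⟩ := hb
  obtain ⟨hclo, hchi⟩ := hc
  have ra₁ : (0 : ℝ) < a₁ := by exact_mod_cast qa₁
  have rc₁ : (0 : ℝ) ≤ c₁ := by exact_mod_cast qc₁
  have rcb : (c₂ : ℝ) ≤ b₁ := by exact_mod_cast qcb
  have rΔ₁ : (0 : ℝ) ≤ Δ₁ := by exact_mod_cast qΔ₁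
  have rv₁ : (0 : ℝ) < v₁ := by exact_mod_cast qv₁
  have rv : (v₁ : ℝ) ≤ v₂ := by exact_mod_cast qv
  have re0 : (0 : ℝ) ≤ e := by exact_mod_cast qe0
  have rE0 : (0 : ℝ) ≤ E := by exact_mod_cast qE0
  have rs₁ : (0 : ℝ) < (Δ₁ : ℝ) + e := by exact_mod_cast qs₁
  have hc0 : 0 ≤ c := rc₁.trans hclo
  have hc₂0 : (0 : ℝ) ≤ c₂ := hc0.trans hchi
  have htpd : 0 < tpd := lt_of_lt_of_le ra₁ halo
  have hΔ0 : 0 ≤ Δ := rΔ₁.trans hΔlo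
  have hb₁0 : (0 : ℝ) ≤ b₁ := hc₂0.trans rcb
  have htpp0 : 0 ≤ tpp := hb₁0.trans hblo
  have hb₂0 : (0 : ℝ) ≤ b₂ := htpp0.trans hbhi
  have hD4 : 0 ≤ Δ + 4 * c := by positivity
  have ha1 : (a₁ : ℝ) ^ 2 ≤ tpd ^ 2 := pow_le_pow_left₀ ra₁.le halo 2
  have ha2 : tpd ^ 2 ≤ (a₂ : ℝ) ^ 2 := pow_le_pow_left₀ htpd.le hahi 2
  -- the energy bracket
  have hvlo : (v₁ : ℝ) ≤ vhEnergy Δ tpd c := by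
    refine le_vhEnergy_of_quad_nonpos hD4 ?_
    have q : (v₁ : ℝ) ^ 2 + ((Δ₂ : ℝ) + 4 * c₂) * v₁ - 4 * (a₁ : ℝ) ^ 2 ≤ 0 := by exact_mod_cast qlo
    have e1 : (Δ + 4 * c) * (v₁ : ℝ) ≤ ((Δ₂ : ℝ) + 4 * c₂) * v₁ := mul_le_mul_of_nonneg_right (by linarith) rv₁.le
    linarith
  have hvhi : vhEnergy Δ tpd c ≤ (v₂ : ℝ) := by
    refine vhEnergy_le_of_quad_nonneg (rv₁.le.trans rv) hD4 ?_
    have q : (0 : ℝ) ≤ (v₂ : ℝ) ^ 2 + ((Δ₁ : ℝ) + 4 * c₁) * v₂ - 4 * (a₂ : ℝ) ^ 2 := by exact_mod_cast qhi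
    have e1 : ((Δ₁ : ℝ) + 4 * c₁) * v₂ ≤ (Δ + 4 * c) * (v₂ : ℝ) :=
      mul_le_mul_of_nonneg_right (by linarith) (rv₁.le.trans rv)
    linarith
  -- the Δ + ε_VH bracket (corner-exact)
  have hSlo : (Δ₁ : ℝ) + e ≤ Δ + vhEnergy Δ tpd c :=
    le_add_vhEnergy rΔ₁ hΔlo ha1 hc0 hchi re0 (by exact_mod_cast qe)
  have hShi : Δ + vhEnergy Δ tpd c ≤ (Δ₂ : ℝ) + E :=
    add_vhEnergy_le hΔhi ha2 hclo hD4 rE0 (by exact_mod_cast qE)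
  have hS0 : 0 < Δ + vhEnergy Δ tpd c := rs₁.trans_le hSlo
  -- positivity for free, the u-bracket
  obtain ⟨hw0, hD⟩ := fsD_vh_pos hΔ0 htpd.ne' c
  have hu : vhRatio Δ tpd tpp c = vhU Δ tpd tpp c * (1 + vhU Δ tpd tpp c) := vhRatio_eq_vhU htpd.ne' hw0.ne'
  have hU : vhU Δ tpd tpp c = 2 * (c + tpp) / (Δ + vhEnergy Δ tpd c) := vhU_eq hΔ0 htpd.ne' tpp c
  have rULo : ((vhULo Δ₂ b₁ c₁ E : ℚ) : ℝ) = 2 * ((c₁ : ℝ) + b₁) / ((Δ₂ : ℝ) + E) := by push_cast [vhULo]; ring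
  have rUHi : ((vhUHi Δ₁ b₂ c₂ e : ℚ) : ℝ) = 2 * ((c₂ : ℝ) + b₂) / ((Δ₁ : ℝ) + e) := by push_cast [vhUHi]; ring
  have hS₂0 : (0 : ℝ) < (Δ₂ : ℝ) + E := hS0.trans_le hShi
  have hULo0 : (0 : ℝ) ≤ ((vhULo Δ₂ b₁ c₁ E : ℚ) : ℝ) := by
    rw [rULo]; exact div_nonneg (by positivity) hS₂0.le
  have hUlo : ((vhULo Δ₂ b₁ c₁ E : ℚ) : ℝ) ≤ vhU Δ tpd tpp c := by
    rw [rULo, hU, div_le_div_iff₀ hS₂0 hS0]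
    have e1 : 2 * ((c₁ : ℝ) + b₁) ≤ 2 * (c + tpp) := by linarith
    exact mul_le_mul e1 hShi hS0.le (by positivity)
  have hUhi : vhU Δ tpd tpp c ≤ ((vhUHi Δ₁ b₂ c₂ e : ℚ) : ℝ) := by
    rw [rUHi, hU, div_le_div_iff₀ hS0 rs₁]
    have e1 : 2 * (c + tpp) ≤ 2 * ((c₂ : ℝ) + b₂) := by linarith
    exact mul_le_mul e1 hSlo rs₁.le (by nlinarith)
  have hU0 : 0 ≤ vhU Δ tpd tpp c := hULo0.trans hUlo
  have hq₁ : (q₁ : ℝ) ≤ vhRatio Δ tpd tpp c := by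
    have q : (q₁ : ℝ) ≤ ((vhULo Δ₂ b₁ c₁ E : ℚ) : ℝ) * (1 + ((vhULo Δ₂ b₁ c₁ E : ℚ) : ℝ)) := by exact_mod_cast qq₁
    rw [hu]; exact q.trans (mul_one_add_mono hULo0 hUlo)
  have hq₂ : vhRatio Δ tpd tpp c ≤ (q₂ : ℝ) := by
    have q : ((vhUHi Δ₁ b₂ c₂ e : ℚ) : ℝ) * (1 + ((vhUHi Δ₁ b₂ c₂ e : ℚ) : ℝ)) ≤ (q₂ : ℝ) := by exact_mod_cast qq₂
    rw [hu]; exact (mul_one_add_mono hU0 hUhi).trans q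
  have hq0 : 0 ≤ vhRatio Δ tpd tpp c := by rw [hu]; exact mul_nonneg hU0 (by linarith)
  -- separation
  have qs : 4 * ((a₂ : ℝ) ^ 2) + 4 * ((b₂ : ℝ) ^ 2) ≤ ((Δ₁ : ℝ) + e) * (((Δ₁ : ℝ) + e) + 2 * v₁) := by exact_mod_cast qsep
  have hsep : VHSep Δ tpd tpp c :=
    vhSep_of_margin rs₁.le rv₁.le hSlo hvlo ha2 (pow_le_pow_left₀ htpp0 hbhi 2) hΔ0 hc0 qs
  have hwin := xVH_mem_Icc_of_vhRatio_mem hΔ0 hc0 hD hq0 hsep ⟨hq₁, hq₂⟩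
  exact ⟨⟨hvlo, hvhi⟩, ⟨hSlo, hShi⟩, ⟨hq₁, hq₂⟩, hsep, xVH_eq hΔ0 hc0 hD hq0 hsep, hwin⟩

/-- TABLE INSERTION: an `x_VH`-window in terms of `Ψ(q₁), Ψ(q₂)` and two certified table entries `Ψ(qa) ≤ ha` (`qa ≤ q₁`),
`lb ≤ Ψ(qb)` (`q₂ ≤ qb`) give the numeric window `x_VH ∈ [1 − 2ha, 1 − 2lb]`. [folklore] -/
theorem xVH_window_of_table {X q₁ q₂ qa qb ha lb : ℝ} (hX : X ∈ Set.Icc (1 - 2 * vhFrac q₁) (1 - 2 * vhFrac q₂))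
    (hqa : qa ≤ q₁) (hqb : q₂ ≤ qb) (hta : vhFrac qa ≤ ha) (htb : lb ≤ vhFrac qb) :
    X ∈ Set.Icc (1 - 2 * ha) (1 - 2 * lb) := by
  obtain ⟨h1, h2⟩ := hX
  exact ⟨by linarith [vhFrac_anti hqa], by linarith [vhFrac_anti hqb]⟩

end Summit.Ventures.CertifiedManyBodySolver.Downfold.Emery
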